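import Summits.CriticalPhenomena.PercolationContinuityZ3.Theorems.PercNearOneGluingNoHeavyLowerTailCovComp
import HarnessLib

/-!
# `NoHeavyLowerTail` (stmt-CriticalPhenomena-4575) — three relays: KN Question 7 at `|A| = 3` from ONE hypothesis-free
# "source–repeller exchange" inequality  (depth prover `nh-dp-commonrelay`, gen 8)

Support file (`--supports stmt-CriticalPhenomena-4575`); no definitions, no named facts, no sorries.  Continues
`…ObserverExchange` / `…CovComp`.  Notation: `μ = prodBernoulli w`, relays `a₁ a₂ a₃`, observer `o`, target `b`,
`R = N₁₃ = {a₁ ↮ a₃}` (a van den Berg–Häggström–Kahn world), `O = {a₁↔o}`, `J = {a₁↔a₂}`, `B = {a₁↔b}`, `T = {a₃↔b}`,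
`N₁ = {a₁ ↮ a₂, a₃}`, `N₂ = {a₂ ↮ a₁, a₃}`, `φ₁ = μ(N₁ ∩ O)/μ(N₁)`, `φ₂ = μ(N₂ ∩ {a₂↔o})/μ(N₂)`, and
`Y := 1_O − φ₂ · 1_J`.  On `R` the events `B` and `T` are disjoint ("`b` in the source's cluster" / "`b` in the repeller's
cluster").

**The new row (Y13), hypothesis-free.**
  `E[Y | R, b ∈ C(a₁)] ≥ E[Y | R, b ∈ C(a₃)]`,
division-free (`g₁ = μ(R∩B)`, `g₃ = μ(R∩T)`, `G₁ = μ(R∩O∩B)`, `G₃ = μ(R∩O∩T)`, `J₁ = μ(R∩J∩B)`, `J₃ = μ(R∩J∩T)`):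
  `μ(N₂∩{a₂↔o}) · (J₁ g₃ − J₃ g₁) ≤ μ(N₂) · (G₁ g₃ − G₃ g₁)`.
In words: moving `b` from the repeller's cluster to the source's cluster raises the (φ₂-discounted) attachment of the observer.
(Y13) is IMPLIED by the pair of registered stubs (K\*g) ∧ (K\*t) of `…CovComp` (`E[Y|R,B] ≥ E[Y|R] ≥ E[Y|R,T]`) and is strictly
weaker; numerically 0 violations (exact enumeration, n ≤ 7, ~2 000 labelled instances incl. two-scale weights; memo RESIDUAL-gen8.md).

**Mechanism (`preFKG3_of_sourceRepellerExchange`).**  The observer-exchange row `[K]` of `…ObserverExchange` is, exactly,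
  `[K] = π₁ (y₁ − φ₁) − π₃ (y₃ − φ₁)`,   `π₁ = g₁/μ(R)`, `π₃ = g₃/μ(R)`, `y₁ = E[Y|R,B]`, `y₃ = E[Y|R,T]`
(because `[K]/μ(R) = E_R[(Y − φ₁)(1_B − 1_T)]`).  Two PROVED facts close it from (Y13): (a) `y₁ ≥ φ₁` (`sre_lemmaY1`: on `R∩B∩J`
KN Lemma 1 + Lemma 2 with the extra increasing event `{a₁↔b, a₂↔b}` — BHK Thm 1.3 for the source SET `{a₁,a₂}` — give
`E[1_O | R, J, B] ≥ φ₁ + φ₂`; on `R∩B∩Jᶜ = N₁∩B` BHK Thm 1.3 for the source `a₁` avoiding `{a₂,a₃}` gives `E[1_O | N₁, B] ≥ φ₁`);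
(b) `π₁ ≥ π₃` is the minimiser hypothesis `τ₃ ≤ τ₁`.  Then `π₃(y₃ − φ₁) ≤ π₁ max(y₃ − φ₁, 0) ≤ π₁(y₁ − φ₁)` (`sre_arith`).
Contents: set bookkeeping, `sre_lemma12B` (Lemma 1+2 with `B`), `sre_cpaN1`, `sre_lemmaY1`, `sre_arith`, the assembly
`preFKG3_of_sourceRepellerExchange` and `preFKG3_of_stubSourceRepellerExchange` (registered stub verbatim).
[cite: KozmaNitzan2024, Theorem 2 (§3.1, pp. 8–9), Lemmas 1–3 (pp. 5–7), Question 7 (§5.5, p. 36); VandenbergHaggstromKahn2005, Thms. 1.3–1.4]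
-/

namespace Summit.CriticalPhenomena.PercolationContinuityZ3.Theorems

open MeasureTheory Set Literature.Probability.LatticeModels Literature.Probability.Percolation

noncomputable section

open Classical

variable {n : ℕ}

/-! ### Set bookkeeping -/

/-- `D₁₂ ∩ ((O₁ ∪ O₂) ∩ (B₁ ∩ B₂)) = (R ∩ (J ∩ B)) ∩ O` (observer and target in the glued world). [folklore] -/
theorem sre_set_W3BO (o b a₁ a₂ a₃ : Fin n) :
    ((openConn a₁ a₃)ᶜ ∩ (openConn a₂ a₃)ᶜ ∩ ((openConn a₁ o ∪ openConn a₂ o) ∩ (openConn a₁ b ∩ openConn a₂ b)) :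
        Set (BondConfig (Fin n))) =
      (openConn a₁ a₃)ᶜ ∩ (openConn a₁ a₂ ∩ openConn a₁ b) ∩ openConn a₁ o := by
  ext ω
  simp only [Set.mem_inter_iff, Set.mem_union, Set.mem_compl_iff, knThm2_mem_openConn]
  constructor
  · rintro ⟨⟨h13, _⟩, hO, h1b, h2b⟩
    have h12 : (openGraph ω).Reachable a₁ a₂ := h1b.trans h2b.symm
    refine ⟨⟨h13, h12, h1b⟩, ?_⟩
    rcases hO with h | h
    · exact h
    · exact h12.trans h
  · rintro ⟨⟨h13, h12, h1b⟩, h1o⟩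
    exact ⟨⟨h13, fun h => h13 (h12.trans h)⟩, Or.inl h1o, h1b, h12.symm.trans h1b⟩

/-- `(R ∩ (O ∩ B)) ∩ J = (R ∩ (J ∩ B)) ∩ O`. [folklore] -/
theorem sre_set_ROB_J (o b a₁ a₂ a₃ : Fin n) :
    (((openConn a₁ a₃)ᶜ ∩ (openConn a₁ o ∩ openConn a₁ b)) ∩ openConn a₁ a₂ : Set (BondConfig (Fin n))) =
      (openConn a₁ a₃)ᶜ ∩ (openConn a₁ a₂ ∩ openConn a₁ b) ∩ openConn a₁ o := by
  ext ω
  simp only [Set.mem_inter_iff, Set.mem_compl_iff]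
  tauto

/-- `(R ∩ (O ∩ B)) \ J = N₁ ∩ (O ∩ B)`. [folklore] -/
theorem sre_set_ROB_Jc (o b a₁ a₂ a₃ : Fin n) :
    (((openConn a₁ a₃)ᶜ ∩ (openConn a₁ o ∩ openConn a₁ b)) \ openConn a₁ a₂ : Set (BondConfig (Fin n))) =
      (openConn a₁ a₂)ᶜ ∩ (openConn a₁ a₃)ᶜ ∩ (openConn a₁ o ∩ openConn a₁ b) := by
  ext ω
  simp only [Set.mem_sdiff, Set.mem_inter_iff, Set.mem_compl_iff]
  tauto

/-- `(R ∩ B) ∩ J = R ∩ (J ∩ B)`. [folklore] -/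
theorem sre_set_RB_J (b a₁ a₂ a₃ : Fin n) :
    (((openConn a₁ a₃)ᶜ ∩ openConn a₁ b) ∩ openConn a₁ a₂ : Set (BondConfig (Fin n))) =
      (openConn a₁ a₃)ᶜ ∩ (openConn a₁ a₂ ∩ openConn a₁ b) := by
  ext ω
  simp only [Set.mem_inter_iff, Set.mem_compl_iff]
  tauto

/-- `(R ∩ B) \ J = N₁ ∩ B`. [folklore] -/
theorem sre_set_RB_Jc (b a₁ a₂ a₃ : Fin n) :
    (((openConn a₁ a₃)ᶜ ∩ openConn a₁ b) \ openConn a₁ a₂ : Set (BondConfig (Fin n))) =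
      (openConn a₁ a₂)ᶜ ∩ (openConn a₁ a₃)ᶜ ∩ openConn a₁ b := by
  ext ω
  simp only [Set.mem_sdiff, Set.mem_inter_iff, Set.mem_compl_iff]
  tauto

/-! ### The two BHK inputs of `y₁ ≥ φ₁` -/

/-- **KN Lemma 1 + Lemma 2 with the target attached, division-free:
`(A₁ P₂ + A₂ P₁) · μ(R ∩ J ∩ B) ≤ P₁ P₂ · μ(R ∩ J ∩ B ∩ O)`**, i.e. `E[1_O | a₁↔a₂↔b, a₁₂ ↮ a₃] ≥ φ₁ + φ₂`
(BHK Thm 1.3 for the source set `{a₁,a₂}` avoiding `a₃` with the increasing events `{o ↔ a₁,a₂}` and `{a₁↔b} ∩ {a₂↔b}`,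
then `stub_knLemma2`).  [cite: KozmaNitzan2024, Lemma 1 (p. 5), Lemma 2 (p. 6); VandenbergHaggstromKahn2005, Thm. 1.3 (p. 6)] -/
theorem sre_lemma12B (w : Sym2 (Fin n) → unitInterval) (o b a₁ a₂ a₃ : Fin n) (h12 : a₁ ≠ a₂) (h13 : a₁ ≠ a₃)
    (h23 : a₂ ≠ a₃) :
    ((prodBernoulli w).real ((openConn a₁ a₂)ᶜ ∩ (openConn a₁ a₃)ᶜ ∩ openConn a₁ o) *
          (prodBernoulli w).real ((openConn a₂ a₁)ᶜ ∩ (openConn a₂ a₃)ᶜ : Set (BondConfig (Fin n))) +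
        (prodBernoulli w).real ((openConn a₂ a₁)ᶜ ∩ (openConn a₂ a₃)ᶜ ∩ openConn a₂ o) *
          (prodBernoulli w).real ((openConn a₁ a₂)ᶜ ∩ (openConn a₁ a₃)ᶜ : Set (BondConfig (Fin n)))) *
        (prodBernoulli w).real ((openConn a₁ a₃)ᶜ ∩ (openConn a₁ a₂ ∩ openConn a₁ b)) ≤
      (prodBernoulli w).real ((openConn a₁ a₂)ᶜ ∩ (openConn a₁ a₃)ᶜ : Set (BondConfig (Fin n))) *
        (prodBernoulli w).real ((openConn a₂ a₁)ᶜ ∩ (openConn a₂ a₃)ᶜ : Set (BondConfig (Fin n))) *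
        (prodBernoulli w).real ((openConn a₁ a₃)ᶜ ∩ (openConn a₁ a₂ ∩ openConn a₁ b) ∩ openConn a₁ o) := by
  -- Lemma 2: A₁' P₁₂ P₂ + A₂' P₁₂ P₁ ≤ A₁₂ P₁ P₂
  have hL := stub_knLemma2 stub_bhkSets n w o a₁ a₂ a₃ h12 h13 h23
  rw [knThm2_openConn_comm o a₁, knThm2_openConn_comm o a₂] at hL
  have e1 : (openConn a₁ o ∩ ((openConn a₁ a₂)ᶜ ∩ (openConn a₁ a₃)ᶜ) : Set (BondConfig (Fin n))) =
      (openConn a₁ a₂)ᶜ ∩ (openConn a₁ a₃)ᶜ ∩ openConn a₁ o := Set.inter_comm _ _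
  have e2 : (openConn a₂ o ∩ ((openConn a₂ a₁)ᶜ ∩ (openConn a₂ a₃)ᶜ) : Set (BondConfig (Fin n))) =
      (openConn a₂ a₁)ᶜ ∩ (openConn a₂ a₃)ᶜ ∩ openConn a₂ o := Set.inter_comm _ _
  have e3 : ((openConn a₁ o ∪ openConn a₂ o) ∩ ((openConn a₁ a₃)ᶜ ∩ (openConn a₂ a₃)ᶜ) : Set (BondConfig (Fin n))) =
      (openConn a₁ a₃)ᶜ ∩ (openConn a₂ a₃)ᶜ ∩ (openConn a₁ o ∪ openConn a₂ o) := Set.inter_comm _ _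
  rw [e1, e2, e3] at hL
  -- Lemma 1 with the target: A₁₂ μ(R∩J∩B) ≤ P₁₂ μ(R∩J∩B∩O)
  have i1 := knThm2_bhkOne stub_bhkSets.1 w {a₁, a₂} ({a₃} : Set (Fin n)) o b (by
    intro s hs
    simp only [Finset.mem_insert, Finset.mem_singleton] at hs
    rcases hs with rfl | rfl
    · simpa using h13
    · simpa using h23)
  rw [knThm2_sep_pair_set, Finset.set_biUnion_insert, Finset.set_biUnion_singleton, Finset.set_biInter_insert,
    Finset.set_biInter_singleton, ← sector_m12_conn, sre_set_W3BO] at i1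
  -- combine
  set P12 := (prodBernoulli w).real ((openConn a₁ a₃)ᶜ ∩ (openConn a₂ a₃)ᶜ : Set (BondConfig (Fin n))) with hP12
  have hP12nn : 0 ≤ P12 := measureReal_nonneg
  have hW : 0 ≤ (prodBernoulli w).real ((openConn a₁ a₃)ᶜ ∩ (openConn a₁ a₂ ∩ openConn a₁ b) : Set (BondConfig (Fin n))) :=
    measureReal_nonneg
  have hP1 : 0 ≤ (prodBernoulli w).real ((openConn a₁ a₂)ᶜ ∩ (openConn a₁ a₃)ᶜ : Set (BondConfig (Fin n))) := measureReal_nonneg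
  have hP2 : 0 ≤ (prodBernoulli w).real ((openConn a₂ a₁)ᶜ ∩ (openConn a₂ a₃)ᶜ : Set (BondConfig (Fin n))) := measureReal_nonneg
  by_cases hz : P12 = 0
  · -- then μ(R∩J∩B) = 0 (it lies inside D₁₂) and the left side vanishes
    have hWle : (prodBernoulli w).real ((openConn a₁ a₃)ᶜ ∩ (openConn a₁ a₂ ∩ openConn a₁ b) : Set (BondConfig (Fin n))) ≤ P12 := by
      rw [hP12]
      refine measureReal_mono ?_
      rintro ω ⟨h13', h12', -⟩
      exact ⟨h13', fun h => h13' (SimpleGraph.Reachable.trans h12' h)⟩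
    have hW0 : (prodBernoulli w).real ((openConn a₁ a₃)ᶜ ∩ (openConn a₁ a₂ ∩ openConn a₁ b) : Set (BondConfig (Fin n))) = 0 :=
      le_antisymm (hz ▸ hWle) hW
    rw [hW0, mul_zero]
    exact mul_nonneg (mul_nonneg hP1 hP2) measureReal_nonneg
  · have hpos : 0 < P12 := lt_of_le_of_ne hP12nn (Ne.symm hz)
    have h1 := mul_le_mul_of_nonneg_right hL hW
    have h2 := mul_le_mul_of_nonneg_left i1 (mul_nonneg hP1 hP2)
    nlinarith [h1, h2, hpos]

/-- **BHK Thm 1.3 in the world `N₁ = {a₁ ↮ a₂, a₃}`: `μ(N₁ ∩ O) μ(N₁ ∩ B) ≤ μ(N₁) μ(N₁ ∩ (O ∩ B))`.**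
[cite: VandenbergHaggstromKahn2005, Thm. 1.3 (p. 6)] -/
theorem sre_cpaN1 (w : Sym2 (Fin n) → unitInterval) (o b a₁ a₂ a₃ : Fin n) (h12 : a₁ ≠ a₂) (h13 : a₁ ≠ a₃) :
    (prodBernoulli w).real ((openConn a₁ a₂)ᶜ ∩ (openConn a₁ a₃)ᶜ ∩ openConn a₁ o) *
        (prodBernoulli w).real ((openConn a₁ a₂)ᶜ ∩ (openConn a₁ a₃)ᶜ ∩ openConn a₁ b) ≤
      (prodBernoulli w).real ((openConn a₁ a₂)ᶜ ∩ (openConn a₁ a₃)ᶜ : Set (BondConfig (Fin n))) *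
        (prodBernoulli w).real ((openConn a₁ a₂)ᶜ ∩ (openConn a₁ a₃)ᶜ ∩ (openConn a₁ o ∩ openConn a₁ b)) := by
  have i1 := knThm2_bhkOne stub_bhkSets.1 w {a₁} ({a₂, a₃} : Set (Fin n)) o b (by
    intro s hs
    simp only [Finset.mem_singleton] at hs
    subst hs
    simp only [Set.mem_insert_iff, Set.mem_singleton_iff, not_or]
    exact ⟨h12, h13⟩)
  rw [knThm2_sep_single_set, Finset.set_biUnion_singleton, Finset.set_biInter_singleton] at i1
  exact i1

/-- **`y₁ ≥ φ₁`, division-free: `P₂ A₁ · μ(R∩B) + P₁ A₂ · μ(R∩J∩B) ≤ P₁ P₂ · μ(R∩O∩B)`.**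
Split `R ∩ B` and `R ∩ O ∩ B` along `J`; the `J`-part is `sre_lemma12B`, the `Jᶜ`-part is `sre_cpaN1`.
[cite: KozmaNitzan2024, Lemmas 1–2 (pp. 5–6); VandenbergHaggstromKahn2005, Thm. 1.3 (p. 6)] -/
theorem sre_lemmaY1 (w : Sym2 (Fin n) → unitInterval) (o b a₁ a₂ a₃ : Fin n) (h12 : a₁ ≠ a₂) (h13 : a₁ ≠ a₃)
    (h23 : a₂ ≠ a₃) :
    (prodBernoulli w).real ((openConn a₂ a₁)ᶜ ∩ (openConn a₂ a₃)ᶜ : Set (BondConfig (Fin n))) *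
          (prodBernoulli w).real ((openConn a₁ a₂)ᶜ ∩ (openConn a₁ a₃)ᶜ ∩ openConn a₁ o) *
          (prodBernoulli w).real ((openConn a₁ a₃)ᶜ ∩ openConn a₁ b) +
        (prodBernoulli w).real ((openConn a₁ a₂)ᶜ ∩ (openConn a₁ a₃)ᶜ : Set (BondConfig (Fin n))) *
          (prodBernoulli w).real ((openConn a₂ a₁)ᶜ ∩ (openConn a₂ a₃)ᶜ ∩ openConn a₂ o) *
          (prodBernoulli w).real ((openConn a₁ a₃)ᶜ ∩ (openConn a₁ a₂ ∩ openConn a₁ b)) ≤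
      (prodBernoulli w).real ((openConn a₁ a₂)ᶜ ∩ (openConn a₁ a₃)ᶜ : Set (BondConfig (Fin n))) *
        (prodBernoulli w).real ((openConn a₂ a₁)ᶜ ∩ (openConn a₂ a₃)ᶜ : Set (BondConfig (Fin n))) *
        (prodBernoulli w).real ((openConn a₁ a₃)ᶜ ∩ (openConn a₁ o ∩ openConn a₁ b)) := by
  have hm : ∀ s : Set (BondConfig (Fin n)), MeasurableSet s := fun _ => MeasurableSet.of_discrete
  -- μ(R∩O∩B) = μ(R∩J∩B∩O) + μ(N₁∩(O∩B)),  μ(R∩B) = μ(R∩J∩B) + μ(N₁∩B)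
  have hs1 := measureReal_inter_add_sdiff (μ := prodBernoulli w)
    (s := ((openConn a₁ a₃)ᶜ ∩ (openConn a₁ o ∩ openConn a₁ b) : Set (BondConfig (Fin n)))) (hm (openConn a₁ a₂))
  rw [sre_set_ROB_J, sre_set_ROB_Jc] at hs1
  have hs2 := measureReal_inter_add_sdiff (μ := prodBernoulli w)
    (s := ((openConn a₁ a₃)ᶜ ∩ openConn a₁ b : Set (BondConfig (Fin n)))) (hm (openConn a₁ a₂))
  rw [sre_set_RB_J, sre_set_RB_Jc] at hs2
  have hA := sre_lemma12B w o b a₁ a₂ a₃ h12 h13 h23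
  have hB := sre_cpaN1 w o b a₁ a₂ a₃ h12 h13
  have hP2 : 0 ≤ (prodBernoulli w).real ((openConn a₂ a₁)ᶜ ∩ (openConn a₂ a₃)ᶜ : Set (BondConfig (Fin n))) := measureReal_nonneg
  have hB' := mul_le_mul_of_nonneg_left hB hP2
  have e1 : (prodBernoulli w).real ((openConn a₂ a₁)ᶜ ∩ (openConn a₂ a₃)ᶜ : Set (BondConfig (Fin n))) *
        (prodBernoulli w).real ((openConn a₁ a₂)ᶜ ∩ (openConn a₁ a₃)ᶜ ∩ openConn a₁ o) *
        (prodBernoulli w).real ((openConn a₁ a₃)ᶜ ∩ openConn a₁ b) =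
      (prodBernoulli w).real ((openConn a₂ a₁)ᶜ ∩ (openConn a₂ a₃)ᶜ : Set (BondConfig (Fin n))) *
        (prodBernoulli w).real ((openConn a₁ a₂)ᶜ ∩ (openConn a₁ a₃)ᶜ ∩ openConn a₁ o) *
        (prodBernoulli w).real ((openConn a₁ a₃)ᶜ ∩ (openConn a₁ a₂ ∩ openConn a₁ b)) +
      (prodBernoulli w).real ((openConn a₂ a₁)ᶜ ∩ (openConn a₂ a₃)ᶜ : Set (BondConfig (Fin n))) *
        (prodBernoulli w).real ((openConn a₁ a₂)ᶜ ∩ (openConn a₁ a₃)ᶜ ∩ openConn a₁ o) *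
        (prodBernoulli w).real ((openConn a₁ a₂)ᶜ ∩ (openConn a₁ a₃)ᶜ ∩ openConn a₁ b) := by
    rw [← hs2]; ring
  have e2 : (prodBernoulli w).real ((openConn a₁ a₂)ᶜ ∩ (openConn a₁ a₃)ᶜ : Set (BondConfig (Fin n))) *
        (prodBernoulli w).real ((openConn a₂ a₁)ᶜ ∩ (openConn a₂ a₃)ᶜ : Set (BondConfig (Fin n))) *
        (prodBernoulli w).real ((openConn a₁ a₃)ᶜ ∩ (openConn a₁ o ∩ openConn a₁ b)) =
      (prodBernoulli w).real ((openConn a₁ a₂)ᶜ ∩ (openConn a₁ a₃)ᶜ : Set (BondConfig (Fin n))) *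
        (prodBernoulli w).real ((openConn a₂ a₁)ᶜ ∩ (openConn a₂ a₃)ᶜ : Set (BondConfig (Fin n))) *
        (prodBernoulli w).real ((openConn a₁ a₃)ᶜ ∩ (openConn a₁ a₂ ∩ openConn a₁ b) ∩ openConn a₁ o) +
      (prodBernoulli w).real ((openConn a₁ a₂)ᶜ ∩ (openConn a₁ a₃)ᶜ : Set (BondConfig (Fin n))) *
        (prodBernoulli w).real ((openConn a₂ a₁)ᶜ ∩ (openConn a₂ a₃)ᶜ : Set (BondConfig (Fin n))) *
        (prodBernoulli w).real ((openConn a₁ a₂)ᶜ ∩ (openConn a₁ a₃)ᶜ ∩ (openConn a₁ o ∩ openConn a₁ b)) := by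
    rw [← hs1]; ring
  rw [e1, e2]
  nlinarith [hA, hB']

/-- **Arithmetic of the assembly.**  From `y₁ ≥ φ₁` (`hY1`), the exchange row (Y13) (`hY`), `g₃ ≤ g₁` and the trivial
inclusions, the observer-exchange row `[K]`: `P₂ A₁ (g₁ − g₃) + P₁ A₂ (J₁ − J₃) ≤ P₁ P₂ (G₁ − G₃)`. [this file] -/
theorem sre_arith {P1 P2 A1 A2 g1 g3 G1 G3 J1 J3 : ℝ}
    (hP1 : 0 ≤ P1) (hg3 : 0 ≤ g3) (hg : g3 ≤ g1)
    (hG1 : 0 ≤ G1) (hG1' : G1 ≤ g1) (hJ1 : 0 ≤ J1) (hJ1' : J1 ≤ g1)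
    (hG3 : 0 ≤ G3) (hG3' : G3 ≤ g3) (hJ3 : 0 ≤ J3) (hJ3' : J3 ≤ g3)
    (hY1 : P2 * A1 * g1 + P1 * A2 * J1 ≤ P1 * P2 * G1)
    (hY : A2 * (J1 * g3 - J3 * g1) ≤ P2 * (G1 * g3 - G3 * g1)) :
    P2 * A1 * (g1 - g3) + P1 * A2 * (J1 - J3) ≤ P1 * P2 * (G1 - G3) := by
  -- Z₁ := P₁P₂G₁ − P₁A₂J₁ − P₂A₁g₁ ≥ 0,  Z₃ := P₁P₂G₃ − P₁A₂J₃ − P₂A₁g₃;  (Y13)·P₁ gives Z₃ g₁ ≤ Z₁ g₃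
  have hZ1 : 0 ≤ P1 * P2 * G1 - P1 * A2 * J1 - P2 * A1 * g1 := by linarith
  have hYP : P1 * (A2 * (J1 * g3 - J3 * g1)) ≤ P1 * (P2 * (G1 * g3 - G3 * g1)) := mul_le_mul_of_nonneg_left hY hP1
  have hcross : (P1 * P2 * G3 - P1 * A2 * J3 - P2 * A1 * g3) * g1 ≤ (P1 * P2 * G1 - P1 * A2 * J1 - P2 * A1 * g1) * g3 := by
    nlinarith [hYP]
  by_cases hg1 : g1 = 0
  · -- everything on `R ∩ B` and `R ∩ T` vanishes
    have hg3z : g3 = 0 := le_antisymm (hg1 ▸ hg) hg3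
    have hG1z : G1 = 0 := le_antisymm (hg1 ▸ hG1') hG1
    have hJ1z : J1 = 0 := le_antisymm (hg1 ▸ hJ1') hJ1
    have hG3z : G3 = 0 := le_antisymm (hg3z ▸ hG3') hG3
    have hJ3z : J3 = 0 := le_antisymm (hg3z ▸ hJ3') hJ3
    subst hg1; subst hg3z; subst hG1z; subst hJ1z; subst hG3z; subst hJ3z
    simp
  · have hg1pos : 0 < g1 := lt_of_le_of_ne (le_trans hg3 hg) (Ne.symm hg1)
    have h3 : (P1 * P2 * G3 - P1 * A2 * J3 - P2 * A1 * g3) * g1 ≤ (P1 * P2 * G1 - P1 * A2 * J1 - P2 * A1 * g1) * g1 := by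
      have := mul_le_mul_of_nonneg_left hg hZ1
      nlinarith [hcross, this]
    have h4 : P1 * P2 * G3 - P1 * A2 * J3 - P2 * A1 * g3 ≤ P1 * P2 * G1 - P1 * A2 * J1 - P2 * A1 * g1 :=
      le_of_mul_le_mul_right h3 hg1pos
    linarith

/-- **KN Question 7 at three relays from the single HYPOTHESIS-FREE source–repeller exchange row (Y13).**  Relays pairwise
distinct, `τ₃ ≤ τ₁`, `τ₃ ≤ τ₂`, `μ(M) > 0`; `hY` is the division-free form of `E[Y | R, b∈C(a₁)] ≥ E[Y | R, b∈C(a₃)]`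
(`R = {a₁ ↮ a₃}`, `Y = 1{o↔a₁} − φ₂ 1{a₁↔a₂}`, `φ₂ = μ(N₂ ∩ {a₂↔o})/μ(N₂)`).  Then `μ(o↔A, a₃↔b) ≤ μ(o↔A, o↔b)`.
Proof: `[K] = π₁(y₁ − φ₁) − π₃(y₃ − φ₁)` with `y₁ ≥ φ₁` (`sre_lemmaY1`) and `π₁ ≥ π₃` (`τ₃ ≤ τ₁`), then
`preFKG3_of_observerExchange`. [cite: KozmaNitzan2024, Theorem 2 (pp. 8–9), Question 7 (p. 36)] -/
theorem preFKG3_of_sourceRepellerExchange (w : Sym2 (Fin n) → unitInterval) (o b a₁ a₂ a₃ : Fin n)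
    (h12 : a₁ ≠ a₂) (h13 : a₁ ≠ a₃) (h23 : a₂ ≠ a₃)
    (hM : 0 < (prodBernoulli w).real ((openConn a₁ a₂)ᶜ ∩ (openConn a₁ a₃)ᶜ ∩ (openConn a₂ a₃)ᶜ : Set (BondConfig (Fin n))))
    (hτ₁ : (prodBernoulli w).real (openConn a₃ b) ≤ (prodBernoulli w).real (openConn a₁ b))
    (hτ₂ : (prodBernoulli w).real (openConn a₃ b) ≤ (prodBernoulli w).real (openConn a₂ b))
    (hY : (prodBernoulli w).real ((openConn a₂ a₁)ᶜ ∩ (openConn a₂ a₃)ᶜ ∩ openConn a₂ o) *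
          ((prodBernoulli w).real ((openConn a₁ a₃)ᶜ ∩ (openConn a₁ a₂ ∩ openConn a₁ b)) *
              (prodBernoulli w).real ((openConn a₁ a₃)ᶜ ∩ openConn a₃ b) -
            (prodBernoulli w).real ((openConn a₁ a₃)ᶜ ∩ (openConn a₁ a₂ ∩ openConn a₃ b)) *
              (prodBernoulli w).real ((openConn a₁ a₃)ᶜ ∩ openConn a₁ b)) ≤
        (prodBernoulli w).real ((openConn a₂ a₁)ᶜ ∩ (openConn a₂ a₃)ᶜ : Set (BondConfig (Fin n))) *
          ((prodBernoulli w).real ((openConn a₁ a₃)ᶜ ∩ (openConn a₁ o ∩ openConn a₁ b)) *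
              (prodBernoulli w).real ((openConn a₁ a₃)ᶜ ∩ openConn a₃ b) -
            (prodBernoulli w).real ((openConn a₁ a₃)ᶜ ∩ (openConn a₁ o ∩ openConn a₃ b)) *
              (prodBernoulli w).real ((openConn a₁ a₃)ᶜ ∩ openConn a₁ b))) :
    (prodBernoulli w).real ((openConn o a₁ ∪ openConn o a₂ ∪ openConn o a₃) ∩ openConn a₃ b) ≤
      (prodBernoulli w).real ((openConn o a₁ ∪ openConn o a₂ ∪ openConn o a₃) ∩ openConn o b) := by
  -- τ₁ − τ₃ = g₁ − g₃ and L₁(O) = G₁ − G₃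
  have htau := cc_tau_sub w b a₁ a₃
  rw [cc_sdiff_eq, cc_sdiff_eq] at htau
  have hL1 := cc_L1_sub w o b a₁ a₃
  rw [cc_sdiff_eq, cc_sdiff_eq] at hL1
  have hg : (prodBernoulli w).real ((openConn a₁ a₃)ᶜ ∩ openConn a₃ b) ≤
      (prodBernoulli w).real ((openConn a₁ a₃)ᶜ ∩ openConn a₁ b) := by linarith [htau, hτ₁]
  -- y₁ ≥ φ₁
  have hY1 := sre_lemmaY1 w o b a₁ a₂ a₃ h12 h13 h23
  -- the observer-exchange row [K]
  have key := sre_arith (P1 := (prodBernoulli w).real ((openConn a₁ a₂)ᶜ ∩ (openConn a₁ a₃)ᶜ : Set (BondConfig (Fin n))))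
    (P2 := (prodBernoulli w).real ((openConn a₂ a₁)ᶜ ∩ (openConn a₂ a₃)ᶜ : Set (BondConfig (Fin n))))
    (A1 := (prodBernoulli w).real ((openConn a₁ a₂)ᶜ ∩ (openConn a₁ a₃)ᶜ ∩ openConn a₁ o))
    (A2 := (prodBernoulli w).real ((openConn a₂ a₁)ᶜ ∩ (openConn a₂ a₃)ᶜ ∩ openConn a₂ o))
    (g1 := (prodBernoulli w).real ((openConn a₁ a₃)ᶜ ∩ openConn a₁ b))
    (g3 := (prodBernoulli w).real ((openConn a₁ a₃)ᶜ ∩ openConn a₃ b))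
    (G1 := (prodBernoulli w).real ((openConn a₁ a₃)ᶜ ∩ (openConn a₁ o ∩ openConn a₁ b)))
    (G3 := (prodBernoulli w).real ((openConn a₁ a₃)ᶜ ∩ (openConn a₁ o ∩ openConn a₃ b)))
    (J1 := (prodBernoulli w).real ((openConn a₁ a₃)ᶜ ∩ (openConn a₁ a₂ ∩ openConn a₁ b)))
    (J3 := (prodBernoulli w).real ((openConn a₁ a₃)ᶜ ∩ (openConn a₁ a₂ ∩ openConn a₃ b)))
    measureReal_nonneg measureReal_nonneg hg
    measureReal_nonneg (measureReal_mono (Set.inter_subset_inter_right _ Set.inter_subset_right))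
    measureReal_nonneg (measureReal_mono (Set.inter_subset_inter_right _ Set.inter_subset_right))
    measureReal_nonneg (measureReal_mono (Set.inter_subset_inter_right _ Set.inter_subset_right))
    measureReal_nonneg (measureReal_mono (Set.inter_subset_inter_right _ Set.inter_subset_right))
    hY1 hY
  refine preFKG3_of_observerExchange w o b a₁ a₂ a₃ h12 h23 hM hτ₁ hτ₂ ?_
  rw [hL1, htau, ← sector_m12_conn, ← cc_set_Jt]
  linarith [key]

/-- **pre-FKG (3) at `a₃` from the REGISTERED hypothesis-free stub `stub_sourceRepellerExchangeThreeRelays` (verbatim, as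
hypothesis `hY`).** [cite: KozmaNitzan2024, Question 7 (p. 36)] -/
theorem preFKG3_of_stubSourceRepellerExchange
    (hY : ∀ (n : ℕ) (w : Sym2 (Fin n) → unitInterval) (o b a₁ a₂ a₃ : Fin n), a₁ ≠ a₂ → a₁ ≠ a₃ → a₂ ≠ a₃ → o ≠ a₁ → o ≠ a₂ → o ≠ a₃ → b ≠ a₁ → b ≠ a₂ → b ≠ a₃ → o ≠ b → (prodBernoulli w).real ((openConn a₂ a₁)ᶜ ∩ (openConn a₂ a₃)ᶜ ∩ openConn a₂ o) * ((prodBernoulli w).real ((openConn a₁ a₃)ᶜ ∩ (openConn a₁ a₂ ∩ openConn a₁ b)) * (prodBernoulli w).real ((openConn a₁ a₃)ᶜ ∩ openConn a₃ b) - (prodBernoulli w).real ((openConn a₁ a₃)ᶜ ∩ (openConn a₁ a₂ ∩ openConn a₃ b)) * (prodBernoulli w).real ((openConn a₁ a₃)ᶜ ∩ openConn a₁ b)) ≤ (prodBernoulli w).real ((openConn a₂ a₁)ᶜ ∩ (openConn a₂ a₃)ᶜ : Set (BondConfig (Fin n))) * ((prodBernoulli w).real ((openConn a₁ a₃)ᶜ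 ∩ (openConn a₁ o ∩ openConn a₁ b)) * (prodBernoulli w).real ((openConn a₁ a₃)ᶜ ∩ openConn a₃ b) - (prodBernoulli w).real ((openConn a₁ a₃)ᶜ ∩ (openConn a₁ o ∩ openConn a₃ b)) * (prodBernoulli w).real ((openConn a₁ a₃)ᶜ ∩ openConn a₁ b)))
    (w : Sym2 (Fin n) → unitInterval) (o b a₁ a₂ a₃ : Fin n)
    (h12 : a₁ ≠ a₂) (h13 : a₁ ≠ a₃) (h23 : a₂ ≠ a₃) (ho1 : o ≠ a₁) (ho2 : o ≠ a₂) (ho3 : o ≠ a₃)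
    (hb1 : b ≠ a₁) (hb2 : b ≠ a₂) (hb3 : b ≠ a₃) (hob : o ≠ b)
    (hM : 0 < (prodBernoulli w).real ((openConn a₁ a₂)ᶜ ∩ (openConn a₁ a₃)ᶜ ∩ (openConn a₂ a₃)ᶜ : Set (BondConfig (Fin n))))
    (hτ₁ : (prodBernoulli w).real (openConn a₃ b) ≤ (prodBernoulli w).real (openConn a₁ b))
    (hτ₂ : (prodBernoulli w).real (openConn a₃ b) ≤ (prodBernoulli w).real (openConn a₂ b)) :
    (prodBernoulli w).real ((openConn o a₁ ∪ openConn o a₂ ∪ openConn o a₃) ∩ openConn a₃ b) ≤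
      (prodBernoulli w).real ((openConn o a₁ ∪ openConn o a₂ ∪ openConn o a₃) ∩ openConn o b) :=
  preFKG3_of_sourceRepellerExchange w o b a₁ a₂ a₃ h12 h13 h23 hM hτ₁ hτ₂
    (hY n w o b a₁ a₂ a₃ h12 h13 h23 ho1 ho2 ho3 hb1 hb2 hb3 hob)

end

end Summit.CriticalPhenomena.PercolationContinuityZ3.Theorems
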